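import Literature.NumberTheory.LFunctions.Zhang2022.SkeletonPartTwo
import Literature.Analysis.Complex.RectangleResiduePolarParts
import HarnessLib

/-!
# Zhang (2022), Lemma 10.2 — the model integrand at shift `β_μ = 0` (triple pole) and its residue
# on a rectangle

Topic `Literature/NumberTheory/LFunctions/Zhang2022` (Landau–Siegel audit tree; verdict-neutral).
Y. Zhang, *Discrete mean estimates and the Landau–Siegel zero*, arXiv:2211.02515v1 (2022)
[Zhang2022LandauSiegel] — **an unrefereed manuscript under adjudication**; DAG nodes `Z22:Lem10.2.pf`,
`Z22:§10.u019`, `Z22:§10.u021`, `Z22:§10.u022` [Z22 p.56, tex L2831–L2851]: "The contour of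
integration is moved in the same way as the proof of Lemma 8.1. Thus, by Lemma 5.8 and 8.2,
`𝔳₂ⱼ(d,r) = (500L′(1,χ)Π(d,r)/log P)·∫_{|s|=10α} [(β_{j+1}+s)(β_{j+2}+s)/s] ((P′₁)ˢ − 2(P′₂)ˢ + (P′₃)ˢ)(dr)⁻ˢ ds/s² + O(𝓛⁻¹⁵)`".

After the tent decomposition `f̃(log y/log P) = (500/log P)Σ_k c_k log⁺(P′_k/y)` the sum `𝔳₂ⱼ(d,r)`
is a combination of the log-weighted sums `Σ_{n<x} χ(n)ξ₀ⱼ(n;d,r)n⁻¹log(x/n)`, `x = P′_k/(dr)` — the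
sums of Lemma 8.4 WITHOUT the twist `(x/n)^{−β_μ}` (shift `β_μ = 0`). The kernel proof of Lemma 8.4
(sz-d27, `Section8Lemma84*`) moves contours through RECTANGLES and compares with the model integrand
`M e^{uL}(u+β_a−β_μ)(u+β_b−β_μ)/((u−β_μ)u²)` (`Section8Lemma84Model`, `β_μ ≠ 0`: a double pole at
`0` and a simple one at `β_μ`). At `β_μ = 0` the two poles merge into a TRIPLE pole; this file PROVES
the corresponding rectangle identity for the model integrand
`G₀(u) = M e^{uL}(u + β_a)(u + β_b)/u³` (`M` standing for `L′(1,χ)Π(d,r)`, `L = log x`,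
`β_a, β_b` for `β_{j+1}, β_{j+2}`):

* `rectBoundaryIntegral_model0` — for every rectangle containing `0` in its interior,
  `∮_{∂R} G₀ = 2πi · M(1 + (β_a + β_b)L + ½β_aβ_bL²)` — the residue at the triple pole is
  `E″(0)/2` for the entire part `E(u) = M e^{uL}(u+β_a)(u+β_b)` (`iteratedDeriv_two_modelEntire0`).

Summed over the tent (`Σ_k c_k = Σ_k c_k L_k = 0`, `Σ_k c_k L_k² = 2(log P/500)²`) these residues
are exactly the values of the manuscript's circle integrals (`Typed.Sec10A.residue102a/b/c_eq`).
Nothing about the manuscript's Theorems 1–2 or about Landau–Siegel zeros is asserted.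

## References

* Y. Zhang, arXiv:2211.02515v1 (2022), §10 Lemma 10.2 (proof), p. 56. [cite: Zhang2022LandauSiegel, §10 Lemma 10.2]
* J. B. Conway, *Functions of One Complex Variable I*, GTM 11, Ch. V §2 Prop. 2.4. [cite: Conway1978, V.2.4]
-/

noncomputable section

open Complex Real Set MeasureTheory Filter Topology intervalIntegral

namespace Literature.NumberTheory.LFunctions.Zhang2022.Lemma102

open Literature.Analysis.Complex

section Model

variable (M βa βb L : ℂ)

/-- The entire part `E(u) = M e^{uL}(u + β_a)(u + β_b)` and its derivative
`E′(u) = M L e^{uL}(u + β_a)(u + β_b) + M e^{uL}((u + β_b) + (u + β_a))`. [folklore] -/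
private theorem hasDerivAt_modelEntire0 (u : ℂ) :
    HasDerivAt (fun u : ℂ => M * cexp (u * L) * ((u + βa) * (u + βb)))
      (M * (L * cexp (u * L)) * ((u + βa) * (u + βb)) + M * cexp (u * L) * ((u + βb) + (u + βa))) u := by
  have he : HasDerivAt (fun u : ℂ => cexp (u * L)) (cexp (u * L) * (1 * L)) u :=
    ((hasDerivAt_id u).mul_const L).cexp
  have hP : HasDerivAt (fun u : ℂ => (u + βa) * (u + βb)) (1 * (u + βb) + (u + βa) * 1) u :=
    ((hasDerivAt_id u).add_const _).mul ((hasDerivAt_id u).add_const _)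
  refine ((he.const_mul M).mul hP).congr_deriv ?_
  ring

/-- The derivative `E′` and ITS derivative. [folklore] -/
private theorem hasDerivAt_deriv_modelEntire0 (u : ℂ) :
    HasDerivAt (fun u : ℂ => M * (L * cexp (u * L)) * ((u + βa) * (u + βb)) +
        M * cexp (u * L) * ((u + βb) + (u + βa)))
      (M * (L * (L * cexp (u * L))) * ((u + βa) * (u + βb)) +
        M * (L * cexp (u * L)) * ((u + βb) + (u + βa)) +
        (M * (L * cexp (u * L)) * ((u + βb) + (u + βa)) + M * cexp (u * L) * 2)) u := by
  have he : HasDerivAt (fun u : ℂ => cexp (u * L)) (cexp (u * L) * (1 * L)) u :=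
    ((hasDerivAt_id u).mul_const L).cexp
  have hLe : HasDerivAt (fun u : ℂ => L * cexp (u * L)) (L * (cexp (u * L) * (1 * L))) u :=
    he.const_mul L
  have hP : HasDerivAt (fun u : ℂ => (u + βa) * (u + βb)) (1 * (u + βb) + (u + βa) * 1) u :=
    ((hasDerivAt_id u).add_const _).mul ((hasDerivAt_id u).add_const _)
  have hQ : HasDerivAt (fun u : ℂ => (u + βb) + (u + βa)) (1 + 1) u :=
    ((hasDerivAt_id u).add_const _).add ((hasDerivAt_id u).add_const _)
  have h1 := (hLe.const_mul M).mul hP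
  have h2 := (he.const_mul M).mul hQ
  refine (h1.add h2).congr_deriv ?_
  ring

/-- The entire part `E(u) = M e^{uL}(u + β_a)(u + β_b)` of the shift-0 model integrand is entire.
[cite: Zhang2022LandauSiegel, §10 Lemma 10.2 (proof)] -/
theorem differentiable_modelEntire0 :
    Differentiable ℂ (fun u : ℂ => M * cexp (u * L) * ((u + βa) * (u + βb))) :=
  fun u => (hasDerivAt_modelEntire0 M βa βb L u).differentiableAt

/-- **`E″(0) = M(β_aβ_bL² + 2(β_a + β_b)L + 2)`** (the second Taylor coefficient at the triple pole).
[cite: Zhang2022LandauSiegel, §10 Lemma 10.2 (proof)] -/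
theorem iteratedDeriv_two_modelEntire0 :
    iteratedDeriv 2 (fun u : ℂ => M * cexp (u * L) * ((u + βa) * (u + βb))) 0 =
      M * (βa * βb * L ^ 2 + 2 * (βa + βb) * L + 2) := by
  have hd1 : deriv (fun u : ℂ => M * cexp (u * L) * ((u + βa) * (u + βb))) =
      fun u => M * (L * cexp (u * L)) * ((u + βa) * (u + βb)) +
        M * cexp (u * L) * ((u + βb) + (u + βa)) :=
    funext fun u => (hasDerivAt_modelEntire0 M βa βb L u).deriv
  rw [show (2 : ℕ) = 1 + 1 from rfl, iteratedDeriv_succ, iteratedDeriv_one, hd1,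
    (hasDerivAt_deriv_modelEntire0 M βa βb L 0).deriv]
  simp only [zero_mul, Complex.exp_zero, zero_add, mul_one]
  ring

/-- The shift-0 model integrand `G₀ = E/u³` is differentiable away from `0`.
[cite: Zhang2022LandauSiegel, §10 Lemma 10.2 (proof)] -/
theorem differentiableAt_model0 {u : ℂ} (hu : u ≠ 0) :
    DifferentiableAt ℂ (fun u : ℂ => M * cexp (u * L) * ((u + βa) * (u + βb)) / u ^ 3) u :=
  ((differentiable_modelEntire0 M βa βb L) u).div (differentiableAt_id.pow 3) (pow_ne_zero 3 hu)

/-- **The "direct calculation" at shift `0` on a rectangle**: for `a < b`, `c < d` with `0` in the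
open rectangle and any `M, β_a, β_b, L ∈ ℂ`,
`∮_{∂R} M e^{uL}(u + β_a)(u + β_b)u⁻³ du = 2πi·M(1 + (β_a + β_b)L + ½β_aβ_bL²)` — the residue
theorem with one pole of order three at `0` (residue `E″(0)/2!`).
[cite: Zhang2022LandauSiegel, §10 Lemma 10.2 (proof)] [cite: Conway1978, V.2.4] -/
theorem rectBoundaryIntegral_model0 {a b c d : ℝ} (hab : a < b) (hcd : c < d)
    (h0 : (0 : ℂ) ∈ Ioo a b ×ℂ Ioo c d) :
    rectBoundaryIntegral (fun u : ℂ => M * cexp (u * L) * ((u + βa) * (u + βb)) / u ^ 3) a b c d =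
      2 * π * I * (M * (1 + (βa + βb) * L + βa * βb * L ^ 2 / 2)) := by
  classical
  set G : ℂ → ℂ := fun u : ℂ => M * cexp (u * L) * ((u + βa) * (u + βb)) / u ^ 3 with hGdef
  set E : ℂ → ℂ := fun u : ℂ => M * cexp (u * L) * ((u + βa) * (u + βb)) with hEdef
  set S : Finset ℂ := {0} with hS
  have hS' : (S : Set ℂ) ⊆ Ioo a b ×ℂ Ioo c d := by
    intro p hp
    simp only [hS, Finset.coe_singleton, Set.mem_singleton_iff] at hp
    rw [hp]; exact h0
  have hF : DifferentiableOn ℂ G (Set.univ \ ↑S) := by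
    intro u hu
    have hu' : u ∉ (S : Set ℂ) := hu.2
    simp only [hS, Finset.coe_singleton, Set.mem_singleton_iff] at hu'
    exact (differentiableAt_model0 M βa βb L hu').differentiableWithinAt
  have hpole : ∀ p ∈ S, ∃ V ∈ 𝓝 p, DifferentiableOn ℂ ((fun _ : ℂ => E) p) V ∧
      ∀ z ∈ V, z ≠ p → G z = (fun _ : ℂ => E) p z / (z - p) ^ ((fun _ : ℂ => 2) p + 1) := by
    intro p hp
    simp only [hS, Finset.mem_singleton] at hp
    subst hp
    refine ⟨Set.univ, Filter.univ_mem, (differentiable_modelEntire0 M βa βb L).differentiableOn, ?_⟩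
    intro z _ hz
    simp only [hGdef, hEdef, sub_zero]
  have hres := rectBoundaryIntegral_eq_sum_of_poles_iteratedDeriv hab hcd S G (fun _ => 2)
    (fun _ => E) Set.univ isOpen_univ (Set.subset_univ _) hS' hF hpole
  rw [hres, hS, Finset.sum_singleton, hEdef, iteratedDeriv_two_modelEntire0]
  simp only [Nat.factorial, Nat.succ_eq_add_one, Nat.reduceAdd, Nat.reduceMul, Nat.cast_ofNat]
  ring

end Model

end Literature.NumberTheory.LFunctions.Zhang2022.Lemma102
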